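import Literature.MathematicalPhysics.QuantumLattice.WilsonDiracLowerBound
import Literature.MathematicalPhysics.QuantumLattice.OverlapGapCommutators
import Literature.MathematicalPhysics.QuantumFieldTheory.QCDPhaseQuenched
import HarnessLib

/-!
# Stub `stub_hjlGap` of line `hermitian-flow-coarea` (reshape r6): the Hernández–Jansen–Lüscher gap (2.16)
# for the `SU(3)` fundamental representation — a corollary of the tree's Neuberger lower bound

Crux `Summit.QuantumFields.QCD.Theses.SpectralDefectExtinction.TipPricing` (item stmt-QuantumFields-8967), line
`hermitian-flow-coarea`, lead c4.  The sibling crux 8964's index transport (`flux_transport_of_HJL`) consumes ONLY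
conjunct (1) of the named fact `HJLLocality (fundamentalRep (Fin 3))` — HJL 1999 (2.16),
`Σ_i ‖(D_W(U,−1,1)ψ)_i‖² ≥ (1 − 30ε) Σ_i ‖ψ_i‖²` for `ε`-norm-admissible fields.  That inequality is ALREADY a theorem of
the tree: Neuberger's lower bound `wilsonDirac_normSq_mulVec_ge_of_plaquette`
(`Literature/MathematicalPhysics/QuantumLattice/WilsonDiracLowerBound.lean`: `(m² − 30δ)‖v‖² ≤ ‖D_W(U,m,1)v‖²` for `m ≥ −1`
whenever `‖1 − ρ(U_p)‖ ≤ δ` for every plaquette in EITHER orientation) at `m = −1`, the orientation being supplied by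
`norm_one_sub_rep_plaquetteHolonomy_le` (`OverlapGapCommutators.lean`: `IsNormAdmissible` quantifies `μ < ν`, the reversed
plaquette is the inverse holonomy, as close to `1` for unitary `ρ`) and `δ = ε ≥ 0` by `IsNormAdmissible.nonneg`.

* `hjlGap_general` — the gap for every group read through a unitary representation on `Fin N` (HJL's generality);
* `stub_hjlGap` — the registered stub: the `SU(3)` fundamental case (`fundamentalRep_mem_unitaryGroup`).

No named facts; axioms standard.  References: P. Hernández, K. Jansen, M. Lüscher, Nucl. Phys. B 552 (1999) 363, (2.16);
H. Neuberger, Phys. Rev. D 61 (2000) 085015, §"Lower bound".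
-/

noncomputable section

namespace Summit.QuantumFields.QCD.Cruxes.TipPricing.HermitianFlowCoarea

open Matrix
open Literature.MathematicalPhysics.QuantumLattice Literature.MathematicalPhysics.QuantumFieldTheory
  Literature.Probability.LatticeModels
open scoped BigOperators Matrix.Norms.L2Operator

/-- **HJL (2.16) for a unitary representation** (Hernández–Jansen–Lüscher 1999; = Neuberger's lower bound at `m = −1`):
for every group `G` read through a representation `ρ` by unitary `N × N` matrices, every periodic four-torus and every
`ε`-norm-admissible field, `(1 − 30ε) Σ_i ‖ψ_i‖² ≤ Σ_i ‖(D_W(U,−1,1)ψ)_i‖²` for every `ψ`. -/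
theorem hjlGap_general {G : Type*} [Group G] {N L : ℕ} [NeZero L] (ρ : G →* Matrix (Fin N) (Fin N) ℂ)
    (hρ : ∀ g, ρ g ∈ Matrix.unitaryGroup (Fin N) ℂ) (U : GaugeConfig 4 L G) (ε : ℝ)
    (hU : IsNormAdmissible ρ U ε) (ψ : TorusSite 4 L × Fin N × Fin 4 → ℂ) :
    (1 - 30 * ε) * ∑ i, ‖ψ i‖ ^ 2 ≤ ∑ i, ‖(wilsonDirac ρ U (-1) 1 *ᵥ ψ) i‖ ^ 2 := by
  have h := wilsonDirac_normSq_mulVec_ge_of_plaquette ρ hρ U (-1) le_rfl ε hU.nonneg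
    (fun y μ ν hμν => norm_one_sub_rep_plaquetteHolonomy_le ρ hρ hU y hμν) ψ
  norm_num at h
  exact h

/-- **STUB `stub_hjlGap`** (registered signature, line `hermitian-flow-coarea` r6) — HJL (2.16) for the `SU(3)` fundamental
representation: on every periodic four-torus, for every `ε`-norm-admissible `SU(3)` field and every `ψ`,
`(1 − 30ε) Σ_i ‖ψ_i‖² ≤ Σ_i ‖(D_W(U,−1,1)ψ)_i‖²`.  Verbatim conjunct (1) of the named fact `HJLLocality (fundamentalRep (Fin 3))`
with its unitarity premise discharged. -/
theorem stub_hjlGap :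
    ∀ {L : ℕ} [NeZero L] (U : GaugeConfig 4 L SU3) (ε : ℝ), IsNormAdmissible (fundamentalRep (Fin 3)) U ε →
      ∀ ψ : TorusSite 4 L × Fin 3 × Fin 4 → ℂ,
        (1 - 30 * ε) * ∑ i, ‖ψ i‖ ^ 2 ≤ ∑ i, ‖(wilsonDirac (fundamentalRep (Fin 3)) U (-1) 1 *ᵥ ψ) i‖ ^ 2 :=
  fun U ε hU ψ => hjlGap_general (fundamentalRep (Fin 3)) fundamentalRep_mem_unitaryGroup U ε hU ψ

/-- Conversely-free cross-check: the registered stub IS conjunct (1) of the named fact at the fundamental representation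
(so discharging `HJLLocality (fundamentalRep (Fin 3))` would also give it). -/
theorem hjlGap_of_HJLLocality (h : HJLLocality (fundamentalRep (Fin 3))) :
    ∀ {L : ℕ} [NeZero L] (U : GaugeConfig 4 L SU3) (ε : ℝ), IsNormAdmissible (fundamentalRep (Fin 3)) U ε →
      ∀ ψ : TorusSite 4 L × Fin 3 × Fin 4 → ℂ,
        (1 - 30 * ε) * ∑ i, ‖ψ i‖ ^ 2 ≤ ∑ i, ‖(wilsonDirac (fundamentalRep (Fin 3)) U (-1) 1 *ᵥ ψ) i‖ ^ 2 :=
  fun U ε hU ψ => h.1 fundamentalRep_mem_unitaryGroup U ε hU ψ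

end Summit.QuantumFields.QCD.Cruxes.TipPricing.HermitianFlowCoarea

end
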